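import Literature.AlgebraicGeometry.Resolution.RegularTensorTower

/-!
# Adjoining finitely many good `p^r`-th roots to the constants keeps a regular algebra regular

Stub `stub_regularTensorAdjoinRoots` (T4) of the line `theta-finite-cofinite-roots` for the crux
`PicoverToRadicialBottom` (stmt-ResolutionOfSingularities-0556).

Let `k` be a field of characteristic `p`, `A` a regular `k`-algebra, `u_i ∈ k` constants and
`D_i` derivations of `A` with `D_i(u_j) = δ_ij`, and `θ_i` elements of an extension `E/k` with
`θ_i^{p^r} = u_i`. Then `k(θ_i : i ∈ S) ⊗ₖ A` is a regular ring for every finite `S`.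

Proof (Stacks 07PG/07PR pattern): induction on `S`, carrying along, for every `j ∉ S`, a
derivation `𝔇_j` of `K_S ⊗ₖ A` (`K_S = k(θ_i : i ∈ S)`) with `𝔇_j(u_l ⊗ 1) = δ_jl`. For the step
`F = K_S ⊂ F(θ_i)`: the minimal polynomial of `θ_i` over `F` is `z^{p^m} - a` with
`a^{p^{r-m}} = u_i`; the derivation `𝔇_i` forces `m = r`, `a = u_i` (or `F ⊗ A = 0`), so
`F(θ_i) ⊗ A ≅ (F ⊗ A)[z]/(z^{p^m} - a ⊗ 1)` is regular by Stacks 07PG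
(`isRegularRing_tensor_of_minpoly_eq_X_pow_sub_C`), and the `𝔇_j`, `j ≠ i`, extend
coefficientwise (they kill `a ⊗ 1`) and descend to the quotient.
-/

noncomputable section

-- single-problem summit: the doubled namespace component `ResolutionOfSingularities` is forced
set_option linter.dupNamespace false

open scoped TensorProduct
open Polynomial IntermediateField Literature.AlgebraicGeometry.Resolution

namespace Summit.ResolutionOfSingularities.ResolutionOfSingularities.Theorems

universe u

/-- Transport of "regular, with derivations `𝔇_j` (`j ∈ J`) such that `𝔇_j(u_l) = δ_jl`" along an
isomorphism of `k`-algebras (a derivation is conjugated by the isomorphism). [folklore] -/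
theorem regular_derivations_of_algEquiv {k : Type*} [Field k] {B₁ B₂ : Type*} [CommRing B₁]
    [CommRing B₂] [Algebra k B₁] [Algebra k B₂] (e : B₁ ≃ₐ[k] B₂) {G : Type*} (u : G → k)
    (J : Set G)
    (h : IsRegularRing B₁ ∧ ∀ j ∈ J, ∃ 𝔇 : Derivation ℤ B₁ B₁,
      𝔇 (algebraMap k B₁ (u j)) = 1 ∧ ∀ l, l ≠ j → 𝔇 (algebraMap k B₁ (u l)) = 0) :
    IsRegularRing B₂ ∧ ∀ j ∈ J, ∃ 𝔇 : Derivation ℤ B₂ B₂,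
      𝔇 (algebraMap k B₂ (u j)) = 1 ∧ ∀ l, l ≠ j → 𝔇 (algebraMap k B₂ (u l)) = 0 := by
  obtain ⟨h₁, h₂⟩ := h
  haveI := h₁
  refine ⟨IsRegularRing.of_ringEquiv e.toRingEquiv, fun j hj => ?_⟩
  obtain ⟨𝔇, h𝔇₁, h𝔇₀⟩ := h₂ j hj
  have hsurj : Function.Surjective (e : B₁ →+* B₂).toIntAlgHom := e.surjective
  have hd : ∀ x, (e : B₁ →+* B₂).toIntAlgHom x = 0 → (e : B₁ →+* B₂).toIntAlgHom (𝔇 x) = 0 := by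
    intro x hx
    rw [RingHom.toIntAlgHom_apply, RingHom.coe_coe, map_eq_zero_iff _ e.injective] at hx
    rw [hx, map_zero, map_zero]
  have hval : ∀ c : k, Derivation.liftOfSurjective hsurj hd (algebraMap k B₂ c) =
      e (𝔇 (algebraMap k B₁ c)) := by
    intro c
    rw [← e.commutes]
    exact Derivation.liftOfSurjective_apply hsurj hd (algebraMap k B₁ c)
  refine ⟨Derivation.liftOfSurjective hsurj hd, ?_, fun l hl => ?_⟩
  · rw [hval, h𝔇₁, map_one]
  · rw [hval, h𝔇₀ l hl, map_zero]

/-- The identification `F(θ) ⊗_R T ≅ (F ⊗_R T)[z]/(g)` of `tensorAdjoinRingEquiv` is compatible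
with the structure maps from `R`. [folklore] -/
theorem tensorAdjoinRingEquiv_algebraMap {R : Type*} [CommRing R] (T : Type*) [CommRing T]
    [Algebra R T] (F : Type u) [Field F] [Algebra R F] {F' : Type u} [Field F'] [Algebra F F']
    [Algebra R F'] [IsScalarTower R F F'] {θ : F'} (hθ : IsIntegral F θ)
    (htop : IntermediateField.adjoin F {θ} = ⊤) (c : R) :
    tensorAdjoinRingEquiv T F hθ htop (algebraMap R (F' ⊗[R] T) c) =
      AdjoinRoot.of ((minpoly F θ).map (algebraMap F (F ⊗[R] T))) (algebraMap R (F ⊗[R] T) c) := by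
  rw [Algebra.TensorProduct.algebraMap_apply, IsScalarTower.algebraMap_apply R F F']
  simp only [tensorAdjoinRingEquiv, RingEquiv.trans_apply,
    AlgEquiv.coe_ringEquiv, Algebra.TensorProduct.cancelBaseChange_symm_tmul,
    Algebra.TensorProduct.comm_tmul, Algebra.TensorProduct.congr_apply,
    Algebra.TensorProduct.map_tmul, AlgEquiv.coe_toAlgHom, AlgEquiv.coe_refl, id_eq,
    AlgEquiv.commutes, AdjoinRoot.algebraMap_eq]
  rw [← Algebra.TensorProduct.one_def, AdjoinRoot.tensorAlgEquiv_of, adjoinRootRidEquiv,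
    AdjoinRoot.coe_mapRingEquiv, AdjoinRoot.map_of, RingEquiv.coe_toRingHom,
    AlgEquiv.coe_ringEquiv, Algebra.TensorProduct.rid_tmul, ← Algebra.algebraMap_eq_smul_one,
    ← IsScalarTower.algebraMap_apply]

/-- **The radical step.** Let `F ⊗ₖ A` be regular with derivations `𝔇_j` (`j ∈ J`) such that
`𝔇_j(u_l ⊗ 1) = δ_jl`, and let `x^{p^r} = u_i` with `i ∈ J`. Then `F(x) ⊗ₖ A` is regular and carries
such derivations for `j ∈ J ∖ {i}`: the minimal polynomial of `x` is `z^{p^m} - a` with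
`a^{p^{r-m}} = u_i`, and `𝔇_i` forces `a = u_i` unless `F ⊗ₖ A = 0`; Stacks 07PG gives regularity
of `F(x) ⊗ₖ A ≅ (F ⊗ₖ A)[z]/(z^{p^m} - a ⊗ 1)`, and `𝔇_j` (which kills `a ⊗ 1`) extends
coefficientwise and descends to the quotient. [cite: StacksProject, Tag 07PG] -/
theorem regular_derivations_adjoin_simple (p : ℕ) [Fact p.Prime] (k : Type u) [Field k]
    [CharP k p] (A : Type*) [CommRing A] [Algebra k A] (r : ℕ) {G : Type*} (u : G → k)
    (F : Type u) [Field F] [Algebra k F] (E : Type u) [Field E] [Algebra F E] [Algebra k E]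
    [IsScalarTower k F E] [IsRegularRing (F ⊗[k] A)] (J : Set G) {i : G} (hi : i ∈ J) (x : E)
    (hx : x ^ p ^ r = algebraMap k E (u i))
    (h𝔇 : ∀ j ∈ J, ∃ 𝔇 : Derivation ℤ (F ⊗[k] A) (F ⊗[k] A),
      𝔇 (algebraMap k _ (u j)) = 1 ∧ ∀ l, l ≠ j → 𝔇 (algebraMap k _ (u l)) = 0) :
    IsRegularRing (↥F⟮x⟯ ⊗[k] A) ∧ ∀ j ∈ J \ {i}, ∃ 𝔇 : Derivation ℤ (↥F⟮x⟯ ⊗[k] A) (↥F⟮x⟯ ⊗[k] A),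
      𝔇 (algebraMap k _ (u j)) = 1 ∧ ∀ l, l ≠ j → 𝔇 (algebraMap k _ (u l)) = 0 := by
  have hp : p.Prime := Fact.out
  haveI : CharP F p := charP_of_injective_algebraMap (algebraMap k F).injective p
  -- `x` is a `p^r`-th root of an element of `F`
  have hxu : x ^ p ^ r = algebraMap F E (algebraMap k F (u i)) := by
    rw [hx, ← IsScalarTower.algebraMap_apply]
  have hxint : IsIntegral F x :=
    IsIntegral.of_pow (pow_pos hp.pos r) (hxu ▸ isIntegral_algebraMap)
  haveI : FiniteDimensional F F⟮x⟯ := adjoin.finiteDimensional hxint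
  -- the minimal polynomial `z^{p^m} - a`
  obtain ⟨m, a, hminx⟩ := (minpoly.natSepDegree_eq_one_iff_eq_X_pow_sub_C p).mp
    ((minpoly.natSepDegree_eq_one_iff_pow_mem p).mpr ⟨r, _, hxu.symm⟩)
  have hmin : minpoly F (AdjoinSimple.gen F x) = X ^ p ^ m - C a := by rw [minpoly_gen, hminx]
  have hxa : x ^ p ^ m = algebraMap F E a := by
    have h := minpoly.aeval F x
    rwa [hminx, map_sub, map_pow, aeval_X, aeval_C, sub_eq_zero] at h
  have hmr : m ≤ r := by
    have h := minpoly.min F x (monic_X_pow_sub_C (algebraMap k F (u i)) (pow_ne_zero r hp.ne_zero))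
      (by rw [map_sub, map_pow, aeval_X, aeval_C, hxu, sub_self])
    rw [hminx, degree_X_pow_sub_C (pow_pos hp.pos m), degree_X_pow_sub_C (pow_pos hp.pos r)] at h
    exact (Nat.pow_le_pow_iff_right hp.one_lt).mp (by exact_mod_cast h)
  have hua : algebraMap k F (u i) = a ^ p ^ (r - m) := by
    apply (algebraMap F E).injective
    rw [map_pow, ← hxa, ← pow_mul, ← pow_add, Nat.add_sub_cancel' hmr, ← hxu]
  -- the derivation `𝔇_i` certifies `a = u_i` (or `F ⊗ A = 0`)
  obtain ⟨𝔇i, h𝔇i₁, -⟩ := h𝔇 i hi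
  have hC : Subsingleton (F ⊗[k] A) ∨ a = algebraMap k F (u i) := by
    rcases hmr.eq_or_lt with h | h
    · right
      rw [hua, h, Nat.sub_self, pow_zero, pow_one]
    · left
      obtain ⟨n, hn⟩ : ∃ n, r - m = n + 1 := ⟨r - m - 1, by omega⟩
      have hp0 : (p : F ⊗[k] A) = 0 := by
        rw [← map_natCast (algebraMap F (F ⊗[k] A)), CharP.cast_eq_zero, map_zero]
      have h1 : 𝔇i (algebraMap k (F ⊗[k] A) (u i)) = 0 := by
        rw [IsScalarTower.algebraMap_apply k F (F ⊗[k] A), hua, hn, pow_succ, pow_mul, map_pow,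
          Derivation.leibniz_pow, nsmul_eq_mul, hp0, zero_mul]
      rw [h𝔇i₁] at h1
      exact subsingleton_of_zero_eq_one h1.symm
  have hunit : IsUnit (𝔇i (algebraMap F (F ⊗[k] A) a)) := by
    rcases hC with h | h
    · exact isUnit_of_subsingleton _
    · rw [h, ← IsScalarTower.algebraMap_apply, h𝔇i₁]
      exact isUnit_one
  -- regularity of `F(x) ⊗ A` (Stacks 07PG)
  have hθ : IsIntegral F (AdjoinSimple.gen F x) := IsIntegral.of_finite F _
  have htop := adjoin_adjoinSimpleGen_eq_top hxint
  have hreg : IsRegularRing (↥F⟮x⟯ ⊗[k] A) :=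
    isRegularRing_tensor_of_minpoly_eq_X_pow_sub_C (R := k) (T := A) (F := F)
      (θ := AdjoinSimple.gen F x) hθ htop hmin 𝔇i hunit
  refine ⟨hreg, fun j hj => ?_⟩
  -- the derivations `𝔇_j`, `j ≠ i`, descend
  obtain ⟨𝔇j, h𝔇j₁, h𝔇j₀⟩ := h𝔇 j hj.1
  have hji : j ≠ i := fun h => hj.2 h
  have h𝔇ja : 𝔇j (algebraMap F (F ⊗[k] A) a) = 0 := by
    rcases hC with h | h
    · exact Subsingleton.elim _ _
    · rw [h, ← IsScalarTower.algebraMap_apply, h𝔇j₀ i hji.symm]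
  -- `F(x) ⊗ A ≅ (F ⊗ A)[z]/(g)` with `g = z^{p^m} - a ⊗ 1`, killed by the extension of `𝔇_j`
  set g : (F ⊗[k] A)[X] := (minpoly F (AdjoinSimple.gen F x)).map (algebraMap F (F ⊗[k] A))
    with hg_def
  have hg : g = X ^ p ^ m - C (algebraMap F (F ⊗[k] A) a) := by
    rw [hg_def, hmin, Polynomial.map_sub, Polynomial.map_pow, map_X, map_C]
  letI : Differential (F ⊗[k] A) := ⟨𝔇j⟩
  have hΔg : Differential.mapCoeffs g = 0 := by
    rw [hg, mapCoeffs_X_pow_sub_C 𝔇j, neg_eq_zero, Polynomial.C_eq_zero]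
    exact h𝔇ja
  -- descent to `AdjoinRoot g`
  have hsurj : Function.Surjective (AdjoinRoot.mk g).toIntAlgHom := AdjoinRoot.mk_surjective
  have hd : ∀ q : (F ⊗[k] A)[X], (AdjoinRoot.mk g).toIntAlgHom q = 0 →
      (AdjoinRoot.mk g).toIntAlgHom (Differential.mapCoeffs q) = 0 := by
    intro q hq
    rw [RingHom.toIntAlgHom_apply, AdjoinRoot.mk_eq_zero] at hq ⊢
    obtain ⟨s, rfl⟩ := hq
    rw [Derivation.leibniz, hΔg, smul_zero, add_zero, smul_eq_mul]
    exact dvd_mul_right g _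
  have hδ : ∀ y : F ⊗[k] A, Derivation.liftOfSurjective hsurj hd (AdjoinRoot.of g y) =
      AdjoinRoot.of g (𝔇j y) := by
    intro y
    have h := Derivation.liftOfSurjective_apply hsurj hd (C y)
    rwa [RingHom.toIntAlgHom_apply, RingHom.toIntAlgHom_apply, Differential.mapCoeffs_C] at h
  -- transport along `e : F(x) ⊗ A ≃ AdjoinRoot g`
  let e := tensorAdjoinRingEquiv (R := k) A F hθ htop
  have hsurj' : Function.Surjective e.symm.toRingHom.toIntAlgHom := e.symm.surjective
  have hd' : ∀ z, e.symm.toRingHom.toIntAlgHom z = 0 →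
      e.symm.toRingHom.toIntAlgHom (Derivation.liftOfSurjective hsurj hd z) = 0 := by
    intro z hz
    rw [RingHom.toIntAlgHom_apply, RingEquiv.toRingHom_eq_coe, RingEquiv.coe_toRingHom,
      map_eq_zero_iff _ e.symm.injective] at hz
    rw [hz, map_zero, map_zero]
  have hval : ∀ c : k, Derivation.liftOfSurjective hsurj' hd' (algebraMap k (↥F⟮x⟯ ⊗[k] A) c) =
      e.symm (AdjoinRoot.of g (𝔇j (algebraMap k (F ⊗[k] A) c))) := by
    intro c
    have h1 : algebraMap k (↥F⟮x⟯ ⊗[k] A) c =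
        e.symm.toRingHom.toIntAlgHom (AdjoinRoot.of g (algebraMap k (F ⊗[k] A) c)) := by
      rw [RingHom.toIntAlgHom_apply, RingEquiv.toRingHom_eq_coe, RingEquiv.coe_toRingHom,
        ← tensorAdjoinRingEquiv_algebraMap A F hθ htop c, RingEquiv.symm_apply_apply]
    rw [h1, Derivation.liftOfSurjective_apply hsurj' hd', hδ]
    rfl
  refine ⟨Derivation.liftOfSurjective hsurj' hd', ?_, fun l hl => ?_⟩
  · rw [hval, h𝔇j₁, map_one, map_one]
  · rw [hval, h𝔇j₀ l hl, map_zero, map_zero]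

/-- (T4) **Adjoining finitely many good `p^r`-th roots to the constants keeps `A` regular.** For a
regular `k`-algebra `A` with derivations `D_i` and constants `u_i` with `D_i(u_j) = δ_ij`, and
`θ_i` with `θ_i^{p^r} = u_i` in an extension `E/k`: `k(θ_i : i ∈ S) ⊗ₖ A` is a regular ring for
every finite `S` (induction on `S`: each step is `F(θ) ⊗ A ≅ (F ⊗ A)[z]/(z^{p^m} - a ⊗ 1)` with
`minpoly_F θ = z^{p^m} - a`; the derivation `D_i` on `F ⊗ A` forces `m = r`, `a = u_i` and makes
Stacks 07PG (`isRegularRing_tensor_of_minpoly_eq_X_pow_sub_C`) applicable; the other `D_j`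
descend to the next stage because `D_j(u_i) = 0`). [cite: StacksProject, Tag 07PG] -/
theorem stub_regularTensorAdjoinRoots :
    ∀ (p : ℕ) [Fact p.Prime] (k : Type) [Field k] [CharP k p] (A : Type) [CommRing A] [Algebra k A]
      [IsRegularRing A] (r : ℕ) (G : Type) (u : G → k) (D : G → Derivation ℤ A A),
      (∀ i, D i (algebraMap k A (u i)) = 1) → (∀ i j, i ≠ j → D i (algebraMap k A (u j)) = 0) →
      ∀ (E : Type) [Field E] [Algebra k E] (θ : G → E), (∀ i, θ i ^ p ^ r = algebraMap k E (u i)) →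
      ∀ S : Finset G,
        IsRegularRing (↥(IntermediateField.adjoin k (θ '' (S : Set G))) ⊗[k] A) := by
  intro p _ k _ _ A _ _ _ r G u D hD₁ hD₀ E _ _ θ hθ S
  classical
  -- induction on `S`, over all models `F ≅ k(θ_i : i ∈ S)`, carrying the derivations `𝔇_j`, `j ∉ S`
  suffices h : ∀ (S : Finset G) (F : Type) [Field F] [Algebra k F],
      (F ≃ₐ[k] ↥(adjoin k (θ '' (S : Set G)))) →
      IsRegularRing (F ⊗[k] A) ∧ ∀ j ∈ (S : Set G)ᶜ, ∃ 𝔇 : Derivation ℤ (F ⊗[k] A) (F ⊗[k] A),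
        𝔇 (algebraMap k _ (u j)) = 1 ∧ ∀ l, l ≠ j → 𝔇 (algebraMap k _ (u l)) = 0 from
    (h S _ AlgEquiv.refl).1
  intro S
  induction S using Finset.induction_on with
  | empty =>
    intro F _ _ e
    have hbot : adjoin k (θ '' ((∅ : Finset G) : Set G)) = ⊥ := by
      rw [Finset.coe_empty, Set.image_empty, adjoin_empty]
    refine regular_derivations_of_algEquiv ((Algebra.TensorProduct.lid k A).symm.trans
      (Algebra.TensorProduct.congr ((e.trans (equivOfEq hbot)).trans (botEquiv k E)).symm
        AlgEquiv.refl)) u _ ⟨‹IsRegularRing A›, fun j _ => ⟨D j, hD₁ j, fun l hl => hD₀ j l hl.symm⟩⟩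
  | insert i S hiS ih =>
    intro F' _ _ e'
    -- the data at stage `S`, for the model `K_S` itself
    obtain ⟨hreg, h𝔇⟩ := ih _ AlgEquiv.refl
    haveI := hreg
    have hstep := regular_derivations_adjoin_simple p k A r u (↥(adjoin k (θ '' (S : Set G)))) E
      (S : Set G)ᶜ (i := i) hiS (θ i) (hθ i) h𝔇
    -- `K_{S ∪ {i}} = K_S(θ_i)`
    have hK : (adjoin (↥(adjoin k (θ '' (S : Set G)))) {θ i}).restrictScalars k =
        adjoin k (θ '' ((insert i S : Finset G) : Set G)) := by
      rw [adjoin_adjoin_left, Finset.coe_insert, Set.image_insert_eq, Set.union_singleton]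
    let e₁ : ↥(adjoin (↥(adjoin k (θ '' (S : Set G)))) {θ i}) ≃ₐ[k]
        ↥(adjoin k (θ '' ((insert i S : Finset G) : Set G))) :=
      Subalgebra.equivOfEq _ _
        ((restrictScalars_toSubalgebra (K := k)).symm.trans (congrArg toSubalgebra hK))
    have h := regular_derivations_of_algEquiv
      (Algebra.TensorProduct.congr (e₁.trans e'.symm) (AlgEquiv.refl : A ≃ₐ[k] A)) u _ hstep
    refine ⟨h.1, fun j hj => h.2 j ⟨fun hjS => hj (Finset.mem_coe.mpr (Finset.mem_insert_of_mem
      (Finset.mem_coe.mp hjS))), fun hji => hj (Finset.mem_coe.mpr ?_)⟩⟩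
    rw [Set.mem_singleton_iff.mp hji]
    exact Finset.mem_insert_self i S

end Summit.ResolutionOfSingularities.ResolutionOfSingularities.Theorems

end
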